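import Literature.Analysis.FluidPDE.TsaiMaximumPrinciple
import HarnessLib

/-!
# A comparison principle for the drift–heat equation `v_t + a·∇v − Δv = 0` with bounded
# measurable drift

Analysis/FluidPDE support file for the discharge of the named fact
`Literature.Analysis.FluidPDE.KNSS2009_lemma21_halfball` (`FluidPDE/KNSSRegularity`: Koch–Nadirashvili–
Seregin–Šverák 2009, Lemma 2.1 — stability of the strong maximum principle — in the half-ball
form used in the proofs of their Theorems 5.1–5.2). KNSS prove Lemma 2.1 by compactness
(weak-* limits of the drifts, locally uniform limits of the solutions via the `W^{2,1}_p`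
regularity of [LSU]) and the strong maximum principle for the limit equation; none of this
machinery is in Mathlib. The fact is vendored for an *elementary* solution class (bounded, `C²`
slices, bounded and jointly continuous `∇v`, `Δv`, time-integrated equation), and for that class
an elementary proof is available: an explicit expanding-ball barrier
(`FluidPDE/DriftHeatBarrier`) and the comparison principle of this file.

## The solution class

Throughout, `v : ℝ → E → ℝ` on a finite-dimensional real inner product space `E`,
`a : ℝ → E → E` is jointly measurable with `‖a(t, y)‖ ≤ A` for `t < 0`, every slice `v(t, ·)`,
`t < 0`, is `C²` with `‖∇v‖, |Δv| ≤ C`, the maps `(t, y) ↦ ∇v(t, ·)(y)` and `(t, y) ↦ Δv(t, ·)(y)`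
are continuous on `(−∞, 0) × E`, and
`v(t, y) − v(s, y) = ∫ₛᵗ (Δv(τ, ·)(y) − Dv(τ, ·)(y)[a(τ, y)]) dτ` for `s ≤ t < 0` (the hypotheses
of `KNSS2009_lemma21_halfball`, which are invariant under `v ↦ M − v`).

## Main statements

* `driftHeat_continuousOn_uncurry`: such a `v` is jointly continuous on `(−∞, 0) × E` (it is
  Lipschitz in `t` and in `y` separately, `driftHeat_abs_sub_time_le`,
  `driftHeat_abs_sub_space_le`).
* `driftHeat_comparison`: **comparison principle** on a region
  `K = {(t, y) : t₁ ≤ t ≤ t₂, ‖y − c‖ ≤ r(t)}`, `t₂ < 0`, `r` continuous: if `φ` is continuous on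
  `[t₁, t₂] × E` with `C²` slices, differentiable in `t` inside `K` with
  `φ_t − Δφ + A‖∇φ‖ ≤ 0` there, and `φ ≤ v` on the bottom `t = t₁` and on the lateral boundary
  `‖y − c‖ = r(t)`, then `φ ≤ v` on `K`.

## Proof of the comparison principle

The classical argument (Lieberman 1996, Ch. II, Lemma 2.1 — the weak maximum principle for
strict subsolutions — and Cor. 2.5, the comparison principle): if `φ − v > 0` somewhere on `K`, the
continuous
function `g = φ − v − ε(t − t₁)` (small `ε > 0`) attains a positive maximum on the compact `K` at
some `(t', y')`, necessarily off the bottom and the lateral boundary. Then `∇φ = ∇v` and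
`Δφ ≤ Δv` at `(t', y')` (second-order condition, `laplacian_nonpos_of_isLocalMax`), and comparing
`g(t, y') ≤ g(t', y')` for `t ↑ t'` with the integrated equation gives
`Δφ − A‖∇φ‖ − o(1) ≤ φ_t − ε`, contradicting the subsolution inequality. The drift is only
measurable, so `v_t` exists only for a.e. `t` (depending on `y`); the point is that the
*integrand* `Δv(τ, y') − Dv(τ, y')[a(τ, y')]` is bounded below near `τ = t'` by joint continuity
of `Δv` and `∇v`, which is all the argument needs.

## References

* G. M. Lieberman, *Second order parabolic differential equations*, World Scientific 1996,
  Ch. II §1, Lemma 2.1 (weak maximum principle) and Corollary 2.5 (comparison principle)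
  [Lieberman1996].
* G. Koch, N. Nadirashvili, G. Seregin, V. Šverák, *Liouville theorems for the Navier–Stokes
  equations and applications*, Acta Math. 203 (2009) 83–105 = arXiv:0709.3599, Lemma 2.1
  [KochNadirashviliSereginSverak2009].
-/

noncomputable section

open MeasureTheory Set Function Filter Topology InnerProductSpace Metric
open scoped RealInnerProductSpace Laplacian ContDiff

namespace Literature.Analysis.FluidPDE

section DriftHeat

variable {E : Type*} [NormedAddCommGroup E] [InnerProductSpace ℝ E] [FiniteDimensional ℝ E]
  [MeasurableSpace E] [BorelSpace E]

omit [MeasurableSpace E] [BorelSpace E] in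
/-- Time-Lipschitz bound for the drift–heat class: `|v(t, y) − v(s, y)| ≤ (C + C A)|t − s|` for
`s, t < 0`, from the integrated equation with bounded integrand. [folklore] -/
theorem driftHeat_abs_sub_time_le {v : ℝ → E → ℝ} {a : ℝ → E → E} {A C : ℝ}
    (ha : ∀ t < 0, ∀ y, ‖a t y‖ ≤ A)
    (hbd : ∀ t < 0, ∀ y, ‖fderiv ℝ (v t) y‖ ≤ C ∧ |(Δ (v t)) y| ≤ C)
    (heq : ∀ y, ∀ s t : ℝ, s ≤ t → t < 0 →
      v t y - v s y = ∫ τ in s..t, ((Δ (v τ)) y - fderiv ℝ (v τ) y (a τ y)))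
    (y : E) {s t : ℝ} (hs : s < 0) (ht : t < 0) :
    |v t y - v s y| ≤ (C + C * A) * |t - s| := by
  -- the integrand is bounded by `C + C A` at negative times
  have hI : ∀ τ < 0, ‖(Δ (v τ)) y - fderiv ℝ (v τ) y (a τ y)‖ ≤ C + C * A := by
    intro τ hτ
    have h1 := (hbd τ hτ y).2
    have h2 : ‖fderiv ℝ (v τ) y (a τ y)‖ ≤ C * A := by
      refine (ContinuousLinearMap.le_opNorm _ _).trans ?_
      exact mul_le_mul (hbd τ hτ y).1 (ha τ hτ y) (norm_nonneg _)
        ((norm_nonneg _).trans (hbd τ hτ y).1)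
    rw [Real.norm_eq_abs] at h2 ⊢
    exact (abs_sub _ _).trans (add_le_add h1 h2)
  rcases le_total s t with hst | hts
  · rw [heq y s t hst ht]
    have := intervalIntegral.norm_integral_le_of_norm_le_const (a := s) (b := t) (C := C + C * A)
      (f := fun τ => (Δ (v τ)) y - fderiv ℝ (v τ) y (a τ y)) (fun τ hτ => hI τ ?_)
    · simpa [Real.norm_eq_abs] using this
    · rw [uIoc_of_le hst] at hτ
      exact lt_of_le_of_lt hτ.2 ht
  · rw [abs_sub_comm, heq y t s hts hs, abs_sub_comm t s]
    have := intervalIntegral.norm_integral_le_of_norm_le_const (a := t) (b := s) (C := C + C * A)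
      (f := fun τ => (Δ (v τ)) y - fderiv ℝ (v τ) y (a τ y)) (fun τ hτ => hI τ ?_)
    · simpa [Real.norm_eq_abs] using this
    · rw [uIoc_of_le hts] at hτ
      exact lt_of_le_of_lt hτ.2 hs

omit [FiniteDimensional ℝ E] [MeasurableSpace E] [BorelSpace E] in
/-- Space-Lipschitz bound for the drift–heat class: `|v(t, y) − v(t, y')| ≤ C ‖y − y'‖`.
[folklore] -/
theorem driftHeat_abs_sub_space_le {v : ℝ → E → ℝ} {C : ℝ} {t : ℝ}
    (hd : Differentiable ℝ (v t)) (hbd : ∀ y, ‖fderiv ℝ (v t) y‖ ≤ C) (y y' : E) :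
    |v t y - v t y'| ≤ C * ‖y - y'‖ := by
  have := Convex.norm_image_sub_le_of_norm_fderiv_le (f := v t) (s := univ)
    (fun x _ => hd x) (fun x _ => hbd x) convex_univ (mem_univ y') (mem_univ y)
  simpa [Real.norm_eq_abs] using this

omit [MeasurableSpace E] [BorelSpace E] in
/-- The drift–heat class is jointly continuous on `(−∞, 0) × E`. [folklore] -/
theorem driftHeat_continuousOn_uncurry {v : ℝ → E → ℝ} {a : ℝ → E → E} {A C : ℝ}
    (ha : ∀ t < 0, ∀ y, ‖a t y‖ ≤ A)
    (hv : ∀ t < 0, Differentiable ℝ (v t))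
    (hbd : ∀ t < 0, ∀ y, ‖fderiv ℝ (v t) y‖ ≤ C ∧ |(Δ (v t)) y| ≤ C)
    (heq : ∀ y, ∀ s t : ℝ, s ≤ t → t < 0 →
      v t y - v s y = ∫ τ in s..t, ((Δ (v τ)) y - fderiv ℝ (v τ) y (a τ y))) :
    ContinuousOn (uncurry v) (Iio 0 ×ˢ univ) := by
  rintro ⟨t₀, y₀⟩ ⟨ht₀, -⟩
  have ht₀' : t₀ < 0 := ht₀
  have hC : 0 ≤ C := (norm_nonneg _).trans (hbd t₀ ht₀' y₀).1
  have hA : 0 ≤ A := (norm_nonneg _).trans (ha t₀ ht₀' y₀)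
  refine ContinuousAt.continuousWithinAt ?_
  rw [Metric.continuousAt_iff]
  intro ε hε
  set K : ℝ := C + C * A + C with hK
  have hK0 : 0 ≤ K := by rw [hK]; positivity
  set δ : ℝ := min (-t₀ / 2) (ε / (K + 1)) with hδ
  have hδpos : 0 < δ := lt_min (by linarith) (div_pos hε (by linarith))
  refine ⟨δ, hδpos, ?_⟩
  rintro ⟨t, y⟩ hdist
  rw [Prod.dist_eq, max_lt_iff] at hdist
  obtain ⟨hdt, hdy⟩ := hdist
  simp only at hdt hdy
  rw [Real.dist_eq] at hdt
  rw [dist_eq_norm] at hdy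
  have ht : t < 0 := by
    have : |t - t₀| < -t₀ / 2 := lt_of_lt_of_le hdt (min_le_left _ _)
    have := (abs_lt.1 this).2
    linarith
  simp only [uncurry_apply_pair, Real.dist_eq]
  have h1 : |v t y - v t y₀| ≤ C * ‖y - y₀‖ :=
    driftHeat_abs_sub_space_le (hv t ht) (fun z => (hbd t ht z).1) y y₀
  have h2 : |v t y₀ - v t₀ y₀| ≤ (C + C * A) * |t - t₀| :=
    driftHeat_abs_sub_time_le ha hbd heq y₀ ht₀' ht
  calc |v t y - v t₀ y₀| = |(v t y - v t y₀) + (v t y₀ - v t₀ y₀)| := by ring_nf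
    _ ≤ |v t y - v t y₀| + |v t y₀ - v t₀ y₀| := abs_add_le _ _
    _ ≤ C * ‖y - y₀‖ + (C + C * A) * |t - t₀| := add_le_add h1 h2
    _ ≤ C * δ + (C + C * A) * δ := by gcongr
    _ = K * δ := by rw [hK]; ring
    _ ≤ K * (ε / (K + 1)) := by gcongr; exact min_le_right _ _
    _ = ε * (K / (K + 1)) := by ring
    _ < ε := by
      refine mul_lt_of_lt_one_right hε ?_
      rw [div_lt_one (by linarith)]
      linarith

/-- Interval integrability of the drift–heat integrand on `[s, t] ⊂ (−∞, 0)`. [folklore] -/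
theorem driftHeat_intervalIntegrable {v : ℝ → E → ℝ} {a : ℝ → E → E} {A C : ℝ}
    (ha_meas : Measurable (uncurry a)) (ha : ∀ t < 0, ∀ y, ‖a t y‖ ≤ A)
    (hbd : ∀ t < 0, ∀ y, ‖fderiv ℝ (v t) y‖ ≤ C ∧ |(Δ (v t)) y| ≤ C)
    (hcD : ContinuousOn (fun p : ℝ × E => fderiv ℝ (v p.1) p.2) (Iio 0 ×ˢ univ))
    (hcΔ : ContinuousOn (fun p : ℝ × E => (Δ (v p.1)) p.2) (Iio 0 ×ˢ univ))
    (y : E) {s t : ℝ} (hst : s ≤ t) (ht : t < 0) :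
    IntervalIntegrable (fun τ => (Δ (v τ)) y - fderiv ℝ (v τ) y (a τ y)) volume s t := by
  rw [intervalIntegrable_iff_integrableOn_Ioc_of_le hst]
  have hsub : Ioc s t ⊆ Iio 0 := fun τ hτ => lt_of_le_of_lt hτ.2 ht
  have hmaps : MapsTo (fun τ : ℝ => (τ, y)) (Ioc s t) (Iio 0 ×ˢ univ) :=
    fun τ hτ => ⟨hsub hτ, mem_univ _⟩
  have hγ : Continuous fun τ : ℝ => (τ, y) := by fun_prop
  have hΔc : ContinuousOn (fun τ : ℝ => (Δ (v τ)) y) (Ioc s t) := by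
    have := hcΔ.comp hγ.continuousOn hmaps
    exact this
  have hDc : ContinuousOn (fun τ : ℝ => fderiv ℝ (v τ) y) (Ioc s t) := by
    have := hcD.comp hγ.continuousOn hmaps
    exact this
  have hmeasΔ : AEStronglyMeasurable (fun τ : ℝ => (Δ (v τ)) y) (volume.restrict (Ioc s t)) :=
    hΔc.aestronglyMeasurable measurableSet_Ioc
  have hmeasD : AEStronglyMeasurable (fun τ : ℝ => fderiv ℝ (v τ) y)
      (volume.restrict (Ioc s t)) :=
    hDc.aestronglyMeasurable measurableSet_Ioc
  have hmeasa : AEStronglyMeasurable (fun τ : ℝ => a τ y) (volume.restrict (Ioc s t)) :=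
    (ha_meas.of_uncurry_right (y := y)).aestronglyMeasurable
  have hmeasDa : AEStronglyMeasurable (fun τ : ℝ => fderiv ℝ (v τ) y (a τ y))
      (volume.restrict (Ioc s t)) := by
    have hg : Continuous (uncurry fun (L : E →L[ℝ] ℝ) (w : E) => L w) :=
      isBoundedBilinearMap_apply.continuous
    exact hg.comp_aestronglyMeasurable₂ hmeasD hmeasa
  refine ⟨hmeasΔ.sub hmeasDa, ?_⟩
  refine HasFiniteIntegral.of_bounded (C := C + C * A) ?_
  rw [ae_restrict_iff' measurableSet_Ioc]
  refine Eventually.of_forall fun τ hτ => ?_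
  have hτ0 : τ < 0 := hsub hτ
  have h1 := (hbd τ hτ0 y).2
  have h2 : ‖fderiv ℝ (v τ) y (a τ y)‖ ≤ C * A := by
    refine (ContinuousLinearMap.le_opNorm _ _).trans ?_
    exact mul_le_mul (hbd τ hτ0 y).1 (ha τ hτ0 y) (norm_nonneg _)
      ((norm_nonneg _).trans (hbd τ hτ0 y).1)
  rw [Real.norm_eq_abs] at h2 ⊢
  exact (abs_sub _ _).trans (add_le_add h1 h2)

/-- **Comparison principle for the drift–heat class** on the space-time region
`K = {(t, y) : t₁ ≤ t ≤ t₂, ‖y − c‖ ≤ r(t)}`: a barrier `φ` with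
`φ_t − Δφ + A‖∇φ‖ ≤ 0` inside `K`, lying below `v` on the bottom and on the lateral boundary of
`K`, lies below `v` on `K` (the comparison principle of Lieberman 1996, Ch. II, Cor. 2.5, proved
as in his Lemma 2.1, for the elementary drift–heat class of this file). The drift `a` is only
measurable; the classical argument at an interior maximum of `φ − v − ε(t − t₁)` goes through
because `∇v` and `Δv` are *jointly* continuous. [cite: Lieberman1996, Ch. II Lemma 2.1 and Cor. 2.5 (variant for measurable drift)] -/
theorem driftHeat_comparison {v φ φₜ : ℝ → E → ℝ} {a : ℝ → E → E} {A C : ℝ} {c : E}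
    {r : ℝ → ℝ} {t₁ t₂ : ℝ} (ht₂ : t₂ < 0)
    (ha_meas : Measurable (uncurry a)) (ha : ∀ t < 0, ∀ y, ‖a t y‖ ≤ A)
    (hv2 : ∀ t < 0, ContDiff ℝ 2 (v t))
    (hbd : ∀ t < 0, ∀ y, ‖fderiv ℝ (v t) y‖ ≤ C ∧ |(Δ (v t)) y| ≤ C)
    (hcD : ContinuousOn (fun p : ℝ × E => fderiv ℝ (v p.1) p.2) (Iio 0 ×ˢ univ))
    (hcΔ : ContinuousOn (fun p : ℝ × E => (Δ (v p.1)) p.2) (Iio 0 ×ˢ univ))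
    (heq : ∀ y, ∀ s t : ℝ, s ≤ t → t < 0 →
      v t y - v s y = ∫ τ in s..t, ((Δ (v τ)) y - fderiv ℝ (v τ) y (a τ y)))
    (hr : Continuous r)
    (hφc : ContinuousOn (uncurry φ) (Icc t₁ t₂ ×ˢ univ))
    (hφ2 : ∀ t ∈ Ioc t₁ t₂, ContDiff ℝ 2 (φ t))
    (hφt : ∀ t ∈ Ioc t₁ t₂, ∀ y, ‖y - c‖ < r t → HasDerivAt (fun s => φ s y) (φₜ t y) t)
    (hsub : ∀ t ∈ Ioc t₁ t₂, ∀ y, ‖y - c‖ < r t →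
      φₜ t y - (Δ (φ t)) y + A * ‖fderiv ℝ (φ t) y‖ ≤ 0)
    (hbot : ∀ y, ‖y - c‖ ≤ r t₁ → φ t₁ y ≤ v t₁ y)
    (hlat : ∀ t ∈ Icc t₁ t₂, ∀ y, ‖y - c‖ = r t → φ t y ≤ v t y) :
    ∀ t ∈ Icc t₁ t₂, ∀ y, ‖y - c‖ ≤ r t → φ t y ≤ v t y := by
  by_contra H
  push Not at H
  obtain ⟨t₀, ht₀, y₀, hy₀, hlt⟩ := H
  have ht₁₂ : t₁ ≤ t₂ := ht₀.1.trans ht₀.2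
  have hA : 0 ≤ A := (norm_nonneg _).trans (ha t₂ ht₂ c)
  -- the perturbation `ε (t - t₁)`
  set δ : ℝ := φ t₀ y₀ - v t₀ y₀ with hδ
  have hδpos : 0 < δ := sub_pos.2 hlt
  set ε : ℝ := δ / (2 * (t₂ - t₁ + 1)) with hε
  have hεpos : 0 < ε := div_pos hδpos (by linarith)
  have hεδ : ε * (t₀ - t₁) < δ := by
    have h1 : ε * (t₀ - t₁) ≤ ε * (t₂ - t₁ + 1) :=
      mul_le_mul_of_nonneg_left (by linarith [ht₀.2]) hεpos.le
    have hT : 0 < t₂ - t₁ + 1 := by linarith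
    have h2 : ε * (t₂ - t₁ + 1) = δ / 2 := by
      rw [hε, div_mul_eq_mul_div, mul_div_mul_right _ _ hT.ne']
    linarith
  -- the compact region `K` and the function `g`
  set K : Set (ℝ × E) := {p | p.1 ∈ Icc t₁ t₂ ∧ ‖p.2 - c‖ ≤ r p.1} with hK
  set g : ℝ × E → ℝ := fun p => φ p.1 p.2 - v p.1 p.2 - ε * (p.1 - t₁) with hg
  obtain ⟨ρ, hρ⟩ : ∃ ρ, ∀ t ∈ Icc t₁ t₂, r t ≤ ρ := by
    obtain ⟨ρ, hρ⟩ := isCompact_Icc.bddAbove_image (f := r) hr.continuousOn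
    exact ⟨ρ, fun t ht => hρ (mem_image_of_mem r ht)⟩
  have hKc : IsCompact K := by
    refine ((isCompact_Icc (a := t₁) (b := t₂)).prod
      (isCompact_closedBall c ρ)).of_isClosed_subset ?_ ?_
    · refine IsClosed.inter (isClosed_Icc.preimage continuous_fst) ?_
      exact isClosed_le (by fun_prop) (hr.comp continuous_fst)
    · rintro ⟨t, y⟩ ⟨ht, hy⟩
      exact ⟨ht, mem_closedBall_iff_norm.2 (hy.trans (hρ t ht))⟩
  have hKsub : K ⊆ Iio 0 ×ˢ univ := fun p hp => ⟨lt_of_le_of_lt hp.1.2 ht₂, mem_univ _⟩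
  have hvc : ContinuousOn (uncurry v) (Iio 0 ×ˢ univ) :=
    driftHeat_continuousOn_uncurry ha (fun t ht => (hv2 t ht).differentiable (by norm_num)) hbd
      heq
  have hgc : ContinuousOn g K := by
    have h1 : ContinuousOn (uncurry φ) K := hφc.mono fun p hp => ⟨hp.1, mem_univ _⟩
    have h2 : ContinuousOn (uncurry v) K := hvc.mono hKsub
    have h3 : Continuous fun p : ℝ × E => ε * (p.1 - t₁) := by fun_prop
    exact (h1.sub h2).sub h3.continuousOn
  -- a maximum point of `g` on `K`
  have hKne : K.Nonempty := ⟨(t₀, y₀), ht₀, hy₀⟩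
  obtain ⟨⟨t', y'⟩, ⟨ht', hy'⟩, hmax⟩ := hKc.exists_isMaxOn hKne hgc
  simp only at ht' hy'
  have hmax' : ∀ t ∈ Icc t₁ t₂, ∀ y, ‖y - c‖ ≤ r t →
      φ t y - v t y - ε * (t - t₁) ≤ φ t' y' - v t' y' - ε * (t' - t₁) :=
    fun t ht y hy => hmax (show (t, y) ∈ K from ⟨ht, hy⟩)
  have hpos : 0 < φ t' y' - v t' y' - ε * (t' - t₁) := by
    have := hmax' t₀ ht₀ y₀ hy₀
    linarith
  -- the maximum point is neither on the bottom nor on the lateral boundary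
  have ht'1 : t₁ < t' := by
    rcases eq_or_lt_of_le ht'.1 with h | h
    · exfalso
      have hb := hbot y' (h ▸ hy')
      rw [← h] at hpos
      simp only [sub_self, mul_zero, sub_zero] at hpos
      linarith
    · exact h
  have ht'I : t' ∈ Ioc t₁ t₂ := ⟨ht'1, ht'.2⟩
  have ht'0 : t' < 0 := lt_of_le_of_lt ht'.2 ht₂
  have hy'lt : ‖y' - c‖ < r t' := by
    rcases eq_or_lt_of_le hy' with h | h
    · exfalso
      have hl := hlat t' ht' y' h
      have : 0 ≤ ε * (t' - t₁) := mul_nonneg hεpos.le (by linarith)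
      linarith
    · exact h
  -- first- and second-order conditions in space at `(t', y')`
  have hloc : IsLocalMax (fun y => φ t' y - v t' y) y' := by
    have hopen : IsOpen {y : E | ‖y - c‖ < r t'} := isOpen_lt (by fun_prop) continuous_const
    filter_upwards [hopen.mem_nhds hy'lt] with y hy
    have := hmax' t' ht' y (le_of_lt hy)
    linarith
  have hF : ContDiff ℝ 2 (fun y => φ t' y - v t' y) := (hφ2 t' ht'I).sub (hv2 t' ht'0)
  have hgrad : fderiv ℝ (φ t') y' = fderiv ℝ (v t') y' := by
    have h0 := hloc.fderiv_eq_zero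
    rw [fderiv_fun_sub ((hφ2 t' ht'I).differentiable (by norm_num) y')
      ((hv2 t' ht'0).differentiable (by norm_num) y')] at h0
    exact sub_eq_zero.1 h0
  have hlap : (Δ (φ t')) y' ≤ (Δ (v t')) y' := by
    have h0 := laplacian_nonpos_of_isLocalMax hF hloc
    have h1 : (Δ (fun y => φ t' y - v t' y)) y' = (Δ (φ t')) y' - (Δ (v t')) y' :=
      ((hφ2 t' ht'I).contDiffAt (x := y')).laplacian_sub ((hv2 t' ht'0).contDiffAt)
    linarith
  -- neighbourhoods in time
  set η : ℝ := ε / (4 * (1 + A)) with hη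
  have hηpos : 0 < η := div_pos hεpos (by linarith)
  -- (i) `y'` stays strictly inside the moving ball
  have h1 : ∀ᶠ t in 𝓝 t', ‖y' - c‖ < r t :=
    (hr.continuousAt (x := t')).eventually (isOpen_Ioi.mem_nhds hy'lt)
  -- (ii) joint continuity of `Δ v` and `∇v` at `(t', y')`
  have hnhds : Iio (0 : ℝ) ×ˢ (univ : Set E) ∈ 𝓝 (t', y') :=
    (isOpen_Iio.prod isOpen_univ).mem_nhds ⟨ht'0, mem_univ _⟩
  have hγ : Continuous fun τ : ℝ => (τ, y') := by fun_prop
  have h2 : ∀ᶠ τ in 𝓝 t', |(Δ (v τ)) y' - (Δ (v t')) y'| < η := by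
    have hc : ContinuousAt (fun τ : ℝ => (Δ (v τ)) y') t' := by
      have := ContinuousAt.comp (f := fun τ : ℝ => (τ, y')) (x := t') (hcΔ.continuousAt hnhds)
        hγ.continuousAt
      exact this
    have := (Metric.tendsto_nhds.1 hc) η hηpos
    simpa [Real.dist_eq] using this
  have h3 : ∀ᶠ τ in 𝓝 t', ‖fderiv ℝ (v τ) y' - fderiv ℝ (v t') y'‖ < η := by
    have hc : ContinuousAt (fun τ : ℝ => fderiv ℝ (v τ) y') t' := by
      have := ContinuousAt.comp (f := fun τ : ℝ => (τ, y')) (x := t') (hcD.continuousAt hnhds)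
        hγ.continuousAt
      exact this
    have := (Metric.tendsto_nhds.1 hc) η hηpos
    simpa [dist_eq_norm] using this
  -- (iii) differentiability of `φ(·, y')` at `t'`
  have h4 : ∀ᶠ t in 𝓝 t', |φ t y' - φ t' y' - (t - t') * φₜ t' y'| ≤ ε / 4 * |t - t'| := by
    have hd := hφt t' ht'I y' hy'lt
    rw [hasDerivAt_iff_isLittleO] at hd
    have := hd.def (show (0 : ℝ) < ε / 4 by linarith)
    simpa only [smul_eq_mul, Real.norm_eq_abs] using this
  -- choose a time `t < t'` in all these neighbourhoods, with `t₁ ≤ t`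
  obtain ⟨d, hdpos, hd⟩ := Metric.eventually_nhds_iff.1 (h1.and (h2.and (h3.and h4)))
  set t : ℝ := max t₁ (t' - d / 2) with htdef
  have htt' : t < t' := max_lt ht'1 (by linarith)
  have ht₁t : t₁ ≤ t := le_max_left _ _
  have htd : t' - d / 2 ≤ t := le_max_right _ _
  have hdist : ∀ τ ∈ Icc t t', dist τ t' < d := fun τ hτ => by
    rw [Real.dist_eq, abs_sub_comm, abs_of_nonneg (by linarith [hτ.2])]
    linarith [hτ.1]
  have htI : t ∈ Icc t₁ t₂ := ⟨ht₁t, htt'.le.trans ht'.2⟩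
  have ht0 : t < 0 := htt'.trans ht'0
  obtain ⟨hrt, -, -, hφ4⟩ := hd (hdist t ⟨le_rfl, htt'.le⟩)
  -- `g (t, y') ≤ g (t', y')`
  have hgt := hmax' t htI y' hrt.le
  -- lower bound for `v t' y' - v t y'` from the equation
  set L : ℝ := (Δ (φ t')) y' - A * ‖fderiv ℝ (φ t') y'‖ - η * (1 + A) with hL
  have hlow : L * (t' - t) ≤ v t' y' - v t y' := by
    rw [heq y' t t' htt'.le ht'0]
    have hint := driftHeat_intervalIntegrable ha_meas ha hbd hcD hcΔ y' htt'.le ht'0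
    have hmono := intervalIntegral.integral_mono_on htt'.le
      (intervalIntegrable_const (μ := volume) (a := t) (b := t') (c := L)) hint
      (fun τ hτ => ?_)
    · simpa [intervalIntegral.integral_const, smul_eq_mul, mul_comm] using hmono
    · -- pointwise lower bound of the integrand on `[t, t']`
      have hτ0 : τ < 0 := lt_of_le_of_lt hτ.2 ht'0
      obtain ⟨-, hΔτ, hDτ, -⟩ := hd (hdist τ hτ)
      have e1 : (Δ (v t')) y' - η < (Δ (v τ)) y' := by
        have := (abs_lt.1 hΔτ).1
        linarith
      have e2 : fderiv ℝ (v τ) y' (a τ y') ≤ A * ‖fderiv ℝ (φ t') y'‖ + η * A := by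
        have f1 : fderiv ℝ (v τ) y' (a τ y') =
            fderiv ℝ (v t') y' (a τ y') + (fderiv ℝ (v τ) y' - fderiv ℝ (v t') y') (a τ y') := by
          rw [sub_apply]; ring
        have f2 : fderiv ℝ (v t') y' (a τ y') ≤ A * ‖fderiv ℝ (φ t') y'‖ := by
          rw [← hgrad]
          refine (le_abs_self _).trans ?_
          rw [← Real.norm_eq_abs]
          refine (ContinuousLinearMap.le_opNorm _ _).trans ?_
          rw [mul_comm]
          exact mul_le_mul_of_nonneg_right (ha τ hτ0 y') (norm_nonneg _)
        have f3 : (fderiv ℝ (v τ) y' - fderiv ℝ (v t') y') (a τ y') ≤ η * A := by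
          refine (le_abs_self _).trans ?_
          rw [← Real.norm_eq_abs]
          refine (ContinuousLinearMap.le_opNorm _ _).trans ?_
          exact mul_le_mul hDτ.le (ha τ hτ0 y') (norm_nonneg _) hηpos.le
        linarith
      rw [hL]
      linarith
  -- upper bound for `φ t' y' - φ t y'` from the time derivative
  have hup : φ t' y' - φ t y' ≤ (t' - t) * (φₜ t' y' + ε / 4) := by
    have := (abs_le.1 hφ4).1
    rw [abs_sub_comm, abs_of_nonneg (by linarith : (0 : ℝ) ≤ t' - t)] at this
    nlinarith
  -- the subsolution inequality at `(t', y')`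
  have hs := hsub t' ht'I y' hy'lt
  -- combine
  have hkey : L * (t' - t) ≤ (t' - t) * (φₜ t' y' + ε / 4) - ε * (t' - t) := by linarith
  have hpos' : 0 < t' - t := by linarith
  have hkey' : L ≤ φₜ t' y' + ε / 4 - ε := by
    by_contra hcon
    push Not at hcon
    nlinarith
  have hηA : η * (1 + A) = ε / 4 := by
    rw [hη]; field_simp
  rw [hL] at hkey'
  linarith

end DriftHeat

end Literature.Analysis.FluidPDE

end
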